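import Literature.NumberTheory.LFunctions.BettinConreyFarmer2013Zeros
import HarnessLib

/-!
# Bettin–Conrey–Farmer 2013, Theorem 1 — Lemma 3: the sums `∑_ρ 1/(|ζ'(ρ)| |ρ − s|²)`

Topic `Literature/NumberTheory/LFunctions`; second "Proofs" companion of
`BettinConreyFarmer2013.lean`. Everything here is PROVED. With `𝒵` the set of non-trivial zeros
(each once), RH, and condition (2) of the paper (through `BettinConreyFarmer2013Zeros.lean`):

* `BCF.exists_sum_kernel_le` — the classical `∑_ρ 1/(1 + (t − γ)²) ≪ log(|t| + 2)`
  (Titchmarsh Thm. 9.2; here over distinct zeros, from the window counts of the tree via the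
  ordinate dictionary `OrdinateDictionary.sum_zetaZeroBox_mul_eq_sum_range` and
  `Montgomery.sum_above_le` / `Montgomery.sum_below_le`);
* `BCF.exists_lemma3` — **Lemma 3 of the paper** in the form actually used: for
  `ε ≤ |Re s − 1/2| ≤ 1` (`0 < ε ≤ 1/2`),
  `S(s) := ∑_ρ 1/(|ζ'(ρ)| |ρ − s|²) ≤ K ε⁻² (1 + |Im s|)^{3/4 − δ/4}`
  (the paper: `∑_ρ |R_N(ρ,s)| N^{∓ε} = S(s) ≪ |s|^{3/4−δ/2+ε}` on `Re s = 1/2 ± ε`, by Cauchy–Schwarz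
  on the zeros with `|ρ − s| < |ρ|/2` and the convergence of `∑ 1/(|ζ'(ρ)||ρ|²)` for the others);
* `BCF.exists_sum_horizontal_le` — on a horizontal segment `Im s = T` at a good height (all
  ordinates at distance `≥ c₀/log(|T|+2)`), `S(σ + iT) ≤ K |T|^{3/2}` for `0 ≤ σ ≤ 1`.

Both are stated as bounds for all finite partial sums over distinct zeros together with the
summability of the family, which is how the contour arguments consume them.

## References

* S. Bettin, J. B. Conrey, D. W. Farmer, Proc. Steklov Inst. Math. 280 (2013), suppl. 2
  (arXiv:1211.5191), §3, Lemma 3 and its proof. [BettinConreyFarmer2013]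
* E. C. Titchmarsh, *The Theory of the Riemann Zeta-Function*, 2nd ed. (1986), §9.2, Thm. 9.2.
-/

noncomputable section

open Complex Filter Set Real
open scoped Topology ComplexConjugate

namespace Literature.NumberTheory.LFunctions

namespace BCF

/-! ## `∑_ρ 1/(1 + (t − γ)²) ≪ log(|t| + 2)` -/

/-- The Cauchy kernel sum over distinct non-trivial zeros with *positive* ordinate is
`≤ 24 C₀ log(|t| + 2)`, `C₀` the window constant of `Montgomery.exists_zetaZeroCount_window_le`.
[cite: Titchmarsh1986, §9.2, Thm. 9.2] -/
theorem sum_kernel_pos_le {C₀ : ℝ} (hC₀ : 0 ≤ C₀)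
    (hW : ∀ u : ℝ, (zetaZeroCount (u + 1) : ℝ) - zetaZeroCount u ≤ C₀ * Real.log (|u| + 2))
    (t : ℝ) (F : Finset ℂ)
    (hF : ∀ ρ ∈ F, ρ ∈ ZetaZeros.riemannZetaNontrivialZeros ∧ 0 < ρ.im) :
    ∑ ρ ∈ F, 1 / (1 + (t - ρ.im) ^ 2) ≤ 24 * C₀ * Real.log (|t| + 2) := by
  classical
  set k : ℝ → ℝ := fun y ↦ 1 / (1 + (t - y) ^ 2) with hk
  have hk0 : ∀ y, 0 ≤ k y := fun y ↦ by rw [hk]; positivity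
  -- the box of height `Tm` containing `F`
  set Tm : ℝ := ∑ ρ ∈ F, ρ.im with hTm
  have hTm : ∀ ρ ∈ F, ρ.im ≤ Tm := fun ρ hρ ↦
    Finset.single_le_sum (f := fun ρ : ℂ ↦ ρ.im) (fun σ hσ ↦ (hF σ hσ).2.le) hρ
  set B := (zetaZeroBox_finite 0 Tm).toFinset with hB
  have hFB : F ⊆ B := fun ρ hρ ↦ by
    rw [hB, Set.Finite.mem_toFinset]
    exact mem_zetaZeroBox_of_ntz (hF ρ hρ).1 (hF ρ hρ).2 (hTm ρ hρ)
  -- `∑_F k ≤ ∑_B m(ρ) k(Im ρ) = ∑_{n < N(Tm)} k(γ_n)`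
  have hmk : ∀ ρ ∈ B, k ρ.im ≤ (riemannZetaZeroOrder ρ : ℝ) * k ρ.im := by
    intro ρ hρ
    rw [hB, Set.Finite.mem_toFinset] at hρ
    have h0 := hρ.1
    have hm : (1 : ℝ) ≤ riemannZetaZeroOrder ρ := by
      exact_mod_cast (riemannZetaZeroOrder_pos_iff (ne_one_of_riemannZeta_eq_zero h0)).2 h0
    nlinarith [hk0 ρ.im]
  have h1 : ∑ ρ ∈ F, k ρ.im ≤ ∑ ρ ∈ B, (riemannZetaZeroOrder ρ : ℝ) * k ρ.im :=
    (Finset.sum_le_sum_of_subset_of_nonneg hFB fun ρ _ _ ↦ hk0 _).trans (Finset.sum_le_sum hmk)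
  have hdict := OrdinateDictionary.sum_zetaZeroBox_mul_eq_sum_range (fun y ↦ ((k y : ℝ) : ℂ)) Tm
  have h2 : ∑ ρ ∈ B, (riemannZetaZeroOrder ρ : ℝ) * k ρ.im =
      ∑ n ∈ Finset.range (zetaZeroCount Tm), k (zetaOrdinate n) := by
    have : ((∑ ρ ∈ B, (riemannZetaZeroOrder ρ : ℝ) * k ρ.im : ℝ) : ℂ) =
        ((∑ n ∈ Finset.range (zetaZeroCount Tm), k (zetaOrdinate n) : ℝ) : ℂ) := by
      push_cast
      exact hdict
    exact_mod_cast this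
  -- the enumeration sum, split at `t`
  set R := Finset.range (zetaZeroCount Tm) with hR
  have hpos : ∀ n : ℕ, 0 < zetaOrdinate n := zetaOrdinate_pos_holds
  have hlog2 : Real.log 2 ≤ Real.log (|t| + 2) :=
    Real.log_le_log two_pos (by linarith [abs_nonneg t])
  have hlog0 : 0 ≤ Real.log (|t| + 2) := (Real.log_nonneg one_le_two).trans hlog2
  have h3 : ∑ n ∈ R, k (zetaOrdinate n) ≤ 24 * C₀ * Real.log (|t| + 2) := by
    rcases le_or_gt 0 t with ht | ht
    · -- `t ≥ 0`
      have habs : |t| = t := abs_of_nonneg ht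
      rw [← Finset.sum_filter_add_sum_filter_not R (fun n ↦ t < zetaOrdinate n)]
      have hA := Montgomery.sum_above_le hC₀ hW (R.filter fun n ↦ t < zetaOrdinate n) ht le_rfl
        (fun n hn ↦ (Finset.mem_filter.1 hn).2)
      have hBel := Montgomery.sum_below_le hC₀ hW (R.filter fun n ↦ ¬ t < zetaOrdinate n) ht le_rfl
        (fun n hn ↦ not_lt.1 (Finset.mem_filter.1 hn).2)
      have eA : ∑ n ∈ R.filter (fun n ↦ t < zetaOrdinate n), k (zetaOrdinate n) =
          ∑ n ∈ R.filter (fun n ↦ t < zetaOrdinate n), 1 / (1 + (zetaOrdinate n - t + 0) ^ 2) :=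
        Finset.sum_congr rfl fun n _ ↦ by rw [hk]; ring
      have eB : ∑ n ∈ R.filter (fun n ↦ ¬ t < zetaOrdinate n), k (zetaOrdinate n) =
          ∑ n ∈ R.filter (fun n ↦ ¬ t < zetaOrdinate n), 1 / (1 + (t - zetaOrdinate n + 0) ^ 2) :=
        Finset.sum_congr rfl fun n _ ↦ by rw [hk]; ring
      rw [eA, eB]
      simp only [zero_add, div_one] at hA hBel
      have hlt : Real.log (t + 2) ≤ Real.log (|t| + 2) := by rw [habs]
      rw [habs] at hlt ⊢
      have e1 := mul_le_mul_of_nonneg_left hlog2 hC₀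
      rw [habs] at hlog2 e1
      nlinarith [mul_le_mul_of_nonneg_left hlt hC₀]
    · -- `t < 0`: all ordinates are above `0`
      have habs : |t| = -t := abs_of_neg ht
      have hA := Montgomery.sum_above_le hC₀ hW R le_rfl (abs_nonneg t) (fun n _ ↦ hpos n)
      have eA : ∑ n ∈ R, k (zetaOrdinate n) =
          ∑ n ∈ R, 1 / (1 + (zetaOrdinate n - 0 + |t|) ^ 2) :=
        Finset.sum_congr rfl fun n _ ↦ by rw [hk, habs]; ring
      rw [eA]
      refine hA.trans ?_
      rw [div_le_iff₀ (by positivity)]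
      have hl2 : Real.log (0 + 2) ≤ Real.log (|t| + 2) := by simpa using hlog2
      have e1 := mul_le_mul_of_nonneg_left hl2 hC₀
      have : 0 ≤ 24 * C₀ * Real.log (|t| + 2) * |t| := by positivity
      nlinarith
  calc ∑ ρ ∈ F, 1 / (1 + (t - ρ.im) ^ 2) = ∑ ρ ∈ F, k ρ.im := rfl
    _ ≤ ∑ ρ ∈ B, (riemannZetaZeroOrder ρ : ℝ) * k ρ.im := h1
    _ = ∑ n ∈ R, k (zetaOrdinate n) := h2
    _ ≤ 24 * C₀ * Real.log (|t| + 2) := h3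

/-- **`∑_ρ 1/(1 + (t − Im ρ)²) ≤ K log(|t| + 2)`** uniformly over finite sets of distinct non-trivial
zeros (both signs of the ordinate, the negative ones by conjugation). [cite: Titchmarsh1986, §9.2, Thm. 9.2] -/
theorem exists_sum_kernel_le :
    ∃ K : ℝ, 0 < K ∧ ∀ t : ℝ, ∀ F : Finset ℂ,
      (∀ ρ ∈ F, ρ ∈ ZetaZeros.riemannZetaNontrivialZeros) →
        ∑ ρ ∈ F, 1 / (1 + (t - ρ.im) ^ 2) ≤ K * Real.log (|t| + 2) := by
  classical
  obtain ⟨C₀, hC₀0, hW⟩ := Montgomery.exists_zetaZeroCount_window_le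
  refine ⟨48 * C₀, by positivity, fun t F hF ↦ ?_⟩
  have hnn : ∀ ρ : ℂ, 0 ≤ 1 / (1 + (t - ρ.im) ^ 2) := fun ρ ↦ by positivity
  rw [← Finset.sum_filter_add_sum_filter_not F (fun ρ : ℂ ↦ 0 < ρ.im)]
  set F₁ := F.filter (fun ρ : ℂ ↦ 0 < ρ.im) with hF₁
  set F₂ := F.filter (fun ρ : ℂ ↦ ¬ 0 < ρ.im) with hF₂
  have h1 : ∑ ρ ∈ F₁, 1 / (1 + (t - ρ.im) ^ 2) ≤ 24 * C₀ * Real.log (|t| + 2) :=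
    sum_kernel_pos_le hC₀0.le hW t F₁ fun ρ hρ ↦ by
      rw [hF₁, Finset.mem_filter] at hρ; exact ⟨hF ρ hρ.1, hρ.2⟩
  have h2 : ∑ ρ ∈ F₂, 1 / (1 + (t - ρ.im) ^ 2) ≤ 24 * C₀ * Real.log (|t| + 2) := by
    have hinj : Set.InjOn (fun ρ : ℂ ↦ conj ρ) F₂ := fun a _ b _ h ↦ by
      simpa using congrArg conj h
    have e1 : ∑ ρ ∈ F₂, 1 / (1 + (t - ρ.im) ^ 2) =
        ∑ ρ ∈ F₂, 1 / (1 + ((-t) - (conj ρ).im) ^ 2) :=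
      Finset.sum_congr rfl fun ρ _ ↦ by rw [Complex.conj_im]; ring
    have e2 : ∑ ρ ∈ F₂, 1 / (1 + ((-t) - (conj ρ).im) ^ 2) =
        ∑ z ∈ F₂.image (fun ρ : ℂ ↦ conj ρ), 1 / (1 + ((-t) - z.im) ^ 2) :=
      (Finset.sum_image (f := fun z : ℂ ↦ 1 / (1 + ((-t) - z.im) ^ 2))
        fun a ha b hb h ↦ hinj ha hb h).symm
    rw [e1, e2]
    have h := sum_kernel_pos_le hC₀0.le hW (-t) (F₂.image fun ρ : ℂ ↦ conj ρ) fun z hz ↦ by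
      rw [Finset.mem_image] at hz
      obtain ⟨ρ, hρ, rfl⟩ := hz
      rw [hF₂, Finset.mem_filter] at hρ
      have hmem := hF ρ hρ.1
      have hneg : ρ.im < 0 :=
        lt_of_le_of_ne (not_lt.1 hρ.2) (ZetaZeros.riemannZetaNontrivialZeros.im_ne_zero hmem)
      exact ⟨ZetaZeros.riemannZetaNontrivialZeros.conj_mem hmem, by simpa using hneg⟩
    rwa [abs_neg] at h
  linarith

/-! ## Lemma 3: `S(s) = ∑_ρ 1/(|ζ'(ρ)| |ρ − s|²)` on `ε ≤ |Re s − 1/2| ≤ 1` -/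

/-- The near/far dichotomy: if `|Im ρ| > 2|Im s| + 2` then `|ρ − s| ≥ ‖ρ‖/2` (for `ρ` on the
critical line and `|Re s − 1/2| ≤ 1`). [cite: BettinConreyFarmer2013, §3, proof of Lemma 3] -/
theorem norm_sub_ge_half (hRH : RiemannHypothesis) {ρ : ℂ} (hρ : ρ ∈ ZetaZeros.riemannZetaNontrivialZeros)
    {s : ℂ} (hfar : 2 * |s.im| + 2 < |ρ.im|) : ‖ρ‖ / 2 ≤ ‖ρ - s‖ := by
  have h1 : |ρ.im - s.im| ≤ ‖ρ - s‖ := by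
    have := Complex.abs_im_le_norm (ρ - s); simpa using this
  have h2 : |ρ.im| - |s.im| ≤ |ρ.im - s.im| := abs_sub_abs_le_abs_sub _ _
  have h3 := ntz_norm_le hRH hρ
  linarith [abs_nonneg s.im]

/-- **Lemma 3 (the far zeros).** Under RH and (2), with `S₂ = ∑_ρ 1/(|ζ'(ρ)|‖ρ‖²)`: for every
finite set `F` of distinct zeros with `|Im ρ| > 2|Im s| + 2` (and `|Re s − 1/2| ≤ 1`),
`∑_{ρ ∈ F} 1/(|ζ'(ρ)| |ρ−s|²) ≤ 4 S₂`. [cite: BettinConreyFarmer2013, §3, proof of Lemma 3] -/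
theorem sum_far_le (hRH : RiemannHypothesis)
    (hsimp : ∀ ρ : ℂ, riemannZeta ρ = 0 → 0 < ρ.re → ρ.re < 1 → deriv riemannZeta ρ ≠ 0)
    {S₂ : ℝ}
    (hS₂ : ∀ F : Finset ℂ, (∀ ρ ∈ F, ρ ∈ ZetaZeros.riemannZetaNontrivialZeros) →
      ∑ ρ ∈ F, 1 / (‖deriv riemannZeta ρ‖ * ‖ρ‖ ^ 2) ≤ S₂)
    (s : ℂ) (F : Finset ℂ)
    (hF : ∀ ρ ∈ F, ρ ∈ ZetaZeros.riemannZetaNontrivialZeros ∧ 2 * |s.im| + 2 < |ρ.im|) :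
    ∑ ρ ∈ F, 1 / (‖deriv riemannZeta ρ‖ * ‖ρ - s‖ ^ 2) ≤ 4 * S₂ := by
  have h := hS₂ F fun ρ hρ ↦ (hF ρ hρ).1
  have hterm : ∀ ρ ∈ F, 1 / (‖deriv riemannZeta ρ‖ * ‖ρ - s‖ ^ 2) ≤
      4 * (1 / (‖deriv riemannZeta ρ‖ * ‖ρ‖ ^ 2)) := by
    intro ρ hρ
    have hmem := (hF ρ hρ).1
    have hd : 0 < ‖deriv riemannZeta ρ‖ := norm_pos_iff.2 (ntz_deriv_ne_zero hsimp hmem)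
    have hn : 0 < ‖ρ‖ := lt_of_lt_of_le (by norm_num) (ntz_half_le_norm hRH hmem)
    have hfar := norm_sub_ge_half hRH hmem (hF ρ hρ).2
    have hρs : 0 < ‖ρ - s‖ := lt_of_lt_of_le (by positivity) hfar
    rw [mul_one_div, div_le_div_iff₀ (by positivity) (by positivity), one_mul]
    have : ‖ρ‖ ^ 2 ≤ 4 * ‖ρ - s‖ ^ 2 := by nlinarith
    nlinarith [mul_le_mul_of_nonneg_left this hd.le]
  calc ∑ ρ ∈ F, 1 / (‖deriv riemannZeta ρ‖ * ‖ρ - s‖ ^ 2)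
      ≤ ∑ ρ ∈ F, 4 * (1 / (‖deriv riemannZeta ρ‖ * ‖ρ‖ ^ 2)) := Finset.sum_le_sum hterm
    _ = 4 * ∑ ρ ∈ F, 1 / (‖deriv riemannZeta ρ‖ * ‖ρ‖ ^ 2) := by rw [Finset.mul_sum]
    _ ≤ 4 * S₂ := by linarith

/-- **Lemma 3 (the near zeros, by Cauchy–Schwarz).** Under RH and (2): for `0 < ε ≤ 1`,
`ε ≤ |Re s − 1/2|`, and a finite set `F` of distinct zeros with `|Im ρ| ≤ 2|Im s| + 2`,
`∑_{ρ ∈ F} 1/(|ζ'(ρ)||ρ−s|²) ≤ ε⁻² √(2C (2|Im s|+2)^{3/2−δ}) √(K_k log(|Im s|+2))`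
where `K_k` is the kernel constant. [cite: BettinConreyFarmer2013, §3, proof of Lemma 3] -/
theorem sum_near_le (hRH : RiemannHypothesis) {δ C : ℝ}
    (hC : ∀ T : ℝ, 2 ≤ T →
      ∑ᶠ ρ ∈ zetaZeroBox 0 T, 1 / ‖deriv riemannZeta ρ‖ ^ 2 ≤ C * T ^ (3 / 2 - δ))
    {Kk : ℝ} (hKk0 : 0 < Kk)
    (hKk : ∀ t : ℝ, ∀ F : Finset ℂ, (∀ ρ ∈ F, ρ ∈ ZetaZeros.riemannZetaNontrivialZeros) →
      ∑ ρ ∈ F, 1 / (1 + (t - ρ.im) ^ 2) ≤ Kk * Real.log (|t| + 2))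
    {ε : ℝ} (hε : 0 < ε) (hε1 : ε ≤ 1) {s : ℂ} (hs : ε ≤ |s.re - 1 / 2|) (F : Finset ℂ)
    (hF : ∀ ρ ∈ F, ρ ∈ ZetaZeros.riemannZetaNontrivialZeros ∧ |ρ.im| ≤ 2 * |s.im| + 2) :
    ∑ ρ ∈ F, 1 / (‖deriv riemannZeta ρ‖ * ‖ρ - s‖ ^ 2) ≤
      ε⁻¹ ^ 2 * (Real.sqrt (2 * C * (2 * |s.im| + 2) ^ (3 / 2 - δ)) *
        Real.sqrt (Kk * Real.log (|s.im| + 2))) := by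
  have hC0 := const_nonneg hC
  set U : ℝ := 2 * |s.im| + 2 with hU
  have hU2 : 2 ≤ U := by rw [hU]; linarith [abs_nonneg s.im]
  -- `|ρ - s|² ≥ ε² (1 + (t - γ)²)`
  have hlow : ∀ ρ ∈ F, ε ^ 2 * (1 + (s.im - ρ.im) ^ 2) ≤ ‖ρ - s‖ ^ 2 := by
    intro ρ hρ
    have hre : (ρ - s).re = 1 / 2 - s.re := by rw [sub_re, ntz_re hRH (hF ρ hρ).1]
    have hsq : ‖ρ - s‖ ^ 2 = (1 / 2 - s.re) ^ 2 + (ρ.im - s.im) ^ 2 := by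
      rw [← Complex.normSq_eq_norm_sq, Complex.normSq_apply, hre, sub_im]; ring
    have h1 : ε ^ 2 ≤ (1 / 2 - s.re) ^ 2 := by
      have : ε ≤ |1 / 2 - s.re| := by rwa [abs_sub_comm] at hs
      nlinarith [abs_nonneg (1 / 2 - s.re), sq_abs (1 / 2 - s.re)]
    have h2 : ε ^ 2 ≤ 1 := by nlinarith
    rw [hsq]
    nlinarith [sq_nonneg (ρ.im - s.im)]
  -- Cauchy–Schwarz with `a = 1/|ζ'|`, `b = 1/|ρ-s|²`
  set a : ℂ → ℝ := fun ρ ↦ 1 / ‖deriv riemannZeta ρ‖ with ha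
  set b : ℂ → ℝ := fun ρ ↦ 1 / ‖ρ - s‖ ^ 2 with hb
  have hab : ∑ ρ ∈ F, 1 / (‖deriv riemannZeta ρ‖ * ‖ρ - s‖ ^ 2) = ∑ ρ ∈ F, a ρ * b ρ :=
    Finset.sum_congr rfl fun ρ _ ↦ by rw [ha, hb]; simp only; rw [one_div_mul_one_div]
  have hCS := Finset.sum_mul_sq_le_sq_mul_sq F a b
  -- `∑ a² ≤ 2C U^{3/2-δ}`
  have hA : ∑ ρ ∈ F, a ρ ^ 2 ≤ 2 * C * U ^ (3 / 2 - δ) := by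
    have h := sum_inv_deriv_sq_le hC hU2 F fun ρ hρ ↦ ⟨(hF ρ hρ).1, (hF ρ hρ).2⟩
    refine le_trans (le_of_eq (Finset.sum_congr rfl fun ρ _ ↦ ?_)) h
    rw [ha]; simp only; rw [one_div_pow]
  -- `∑ b² ≤ ε⁻⁴ Kk log(|t|+2)`
  have hB : ∑ ρ ∈ F, b ρ ^ 2 ≤ (ε⁻¹ ^ 2) ^ 2 * (Kk * Real.log (|s.im| + 2)) := by
    have hk := hKk s.im F fun ρ hρ ↦ (hF ρ hρ).1
    calc ∑ ρ ∈ F, b ρ ^ 2 ≤ ∑ ρ ∈ F, (ε⁻¹ ^ 2) ^ 2 * (1 / (1 + (s.im - ρ.im) ^ 2)) := by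
          refine Finset.sum_le_sum fun ρ hρ ↦ ?_
          have hl := hlow ρ hρ
          have hpos : 0 < ε ^ 2 * (1 + (s.im - ρ.im) ^ 2) := by positivity
          have hρs : 0 < ‖ρ - s‖ ^ 2 := hpos.trans_le hl
          -- `b ρ ≤ ε⁻²/(1 + (t-γ)²)` and `b ρ ≤ ε⁻²`... we use `b² ≤ (ε⁻²)² · 1/(1+(t-γ)²)`
          have hb1 : b ρ ≤ ε⁻¹ ^ 2 / (1 + (s.im - ρ.im) ^ 2) := by
            rw [hb]; simp only
            rw [div_le_div_iff₀ hρs (by positivity), one_mul, inv_pow, ← one_div]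
            rw [div_mul_eq_mul_div, le_div_iff₀ (by positivity), one_mul]
            linarith
          have hb2 : b ρ ≤ ε⁻¹ ^ 2 := by
            refine hb1.trans (div_le_self (by positivity) ?_)
            nlinarith [sq_nonneg (s.im - ρ.im)]
          have hb0 : 0 ≤ b ρ := by rw [hb]; positivity
          calc b ρ ^ 2 = b ρ * b ρ := sq _
            _ ≤ ε⁻¹ ^ 2 * (ε⁻¹ ^ 2 / (1 + (s.im - ρ.im) ^ 2)) :=
                mul_le_mul hb2 hb1 hb0 (by positivity)
            _ = (ε⁻¹ ^ 2) ^ 2 * (1 / (1 + (s.im - ρ.im) ^ 2)) := by ring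
      _ = (ε⁻¹ ^ 2) ^ 2 * ∑ ρ ∈ F, 1 / (1 + (s.im - ρ.im) ^ 2) := by rw [Finset.mul_sum]
      _ ≤ (ε⁻¹ ^ 2) ^ 2 * (Kk * Real.log (|s.im| + 2)) :=
          mul_le_mul_of_nonneg_left hk (by positivity)
  -- conclude
  have hlog0 : 0 ≤ Real.log (|s.im| + 2) := Real.log_nonneg (by linarith [abs_nonneg s.im])
  have hR0 : 0 ≤ ε⁻¹ ^ 2 * (Real.sqrt (2 * C * U ^ (3 / 2 - δ)) *
      Real.sqrt (Kk * Real.log (|s.im| + 2))) := by positivity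
  rw [hab]
  refine le_of_pow_le_pow_left₀ two_ne_zero hR0 (hCS.trans ?_)
  have e : (ε⁻¹ ^ 2 * (Real.sqrt (2 * C * U ^ (3 / 2 - δ)) * Real.sqrt (Kk * Real.log (|s.im| + 2)))) ^ 2
      = (2 * C * U ^ (3 / 2 - δ)) * ((ε⁻¹ ^ 2) ^ 2 * (Kk * Real.log (|s.im| + 2))) := by
    rw [mul_pow, mul_pow, Real.sq_sqrt (by positivity), Real.sq_sqrt (by positivity)]; ring
  rw [e]
  exact mul_le_mul hA hB (Finset.sum_nonneg fun ρ _ ↦ sq_nonneg _) (by positivity)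

/-- Partial sums over distinct zeros are bounded by the sum of a summable family on the subtype
of non-trivial zeros (non-negative terms). [folklore] -/
theorem sum_le_tsum_ntz {f : ℂ → ℝ} (hf : ∀ ρ, 0 ≤ f ρ)
    (hsum : Summable fun ρ : ZetaZeros.riemannZetaNontrivialZeros ↦ f ρ) (F : Finset ℂ)
    (hF : ∀ ρ ∈ F, ρ ∈ ZetaZeros.riemannZetaNontrivialZeros) :
    ∑ ρ ∈ F, f ρ ≤ ∑' ρ : ZetaZeros.riemannZetaNontrivialZeros, f ρ := by
  classical
  rw [← Finset.sum_subtype_of_mem f hF]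
  exact hsum.sum_le_tsum _ fun ρ _ ↦ hf ρ

/-- `log(T + 2) ≤ (log 2 + 1/a)(1 + T)^a` for `T ≥ 0`, `a > 0`. [folklore] -/
theorem log_add_two_le_rpow_one_add {a : ℝ} (ha : 0 < a) {T : ℝ} (hT : 0 ≤ T) :
    Real.log (T + 2) ≤ (Real.log 2 + 1 / a) * (1 + T) ^ a := by
  have hx : 1 ≤ 1 + T := by linarith
  have h1 : Real.log (T + 2) ≤ Real.log 2 + Real.log (1 + T) := by
    rw [← Real.log_mul (by norm_num) (by linarith)]
    exact Real.log_le_log (by linarith) (by linarith)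
  have h2 : Real.log (1 + T) ≤ (1 + T) ^ a / a := Real.log_le_rpow_div (by linarith) ha
  have h3 : (1 : ℝ) ≤ (1 + T) ^ a := Real.one_le_rpow hx ha.le
  have hlog2 : 0 ≤ Real.log 2 := Real.log_nonneg one_le_two
  calc Real.log (T + 2) ≤ Real.log 2 + (1 + T) ^ a / a := by linarith
    _ ≤ Real.log 2 * (1 + T) ^ a + (1 + T) ^ a / a := by nlinarith
    _ = (Real.log 2 + 1 / a) * (1 + T) ^ a := by ring

/-- **Lemma 3 of [BettinConreyFarmer2013]** (in the form used in the proof of Theorem 1). Assume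
RH, simple zeros and condition (2) with `0 < δ ≤ 1`. There is `K > 0` such that for `0 < ε ≤ 1` and
every `s` with `ε ≤ |Re s − 1/2| ≤ 1`, all finite partial sums over distinct non-trivial zeros of
`1/(|ζ'(ρ)| |ρ − s|²)` are `≤ K ε⁻² (1 + |Im s|)^{3/4 − δ/4}` (the paper: "for `Re s = 1/2 ± ε`
one has `∑_ρ |R_N(ρ,s)| ≪ N^{∓ε} |s|^{3/4−δ/2+ε}`", `R_N(ρ,s) = N^{ρ−s}/(ζ'(ρ)(ρ−s)²)`).
[cite: BettinConreyFarmer2013, §3, Lemma 3] -/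
theorem exists_lemma3 (hRH : RiemannHypothesis)
    (hsimp : ∀ ρ : ℂ, riemannZeta ρ = 0 → 0 < ρ.re → ρ.re < 1 → deriv riemannZeta ρ ≠ 0)
    {δ C : ℝ} (hδ : 0 < δ) (hδ1 : δ ≤ 1)
    (hC : ∀ T : ℝ, 2 ≤ T →
      ∑ᶠ ρ ∈ zetaZeroBox 0 T, 1 / ‖deriv riemannZeta ρ‖ ^ 2 ≤ C * T ^ (3 / 2 - δ)) :
    ∃ K : ℝ, 0 < K ∧ ∀ ε : ℝ, 0 < ε → ε ≤ 1 → ∀ s : ℂ, ε ≤ |s.re - 1 / 2| → |s.re - 1 / 2| ≤ 1 →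
      ∀ F : Finset ℂ, (∀ ρ ∈ F, ρ ∈ ZetaZeros.riemannZetaNontrivialZeros) →
        ∑ ρ ∈ F, 1 / (‖deriv riemannZeta ρ‖ * ‖ρ - s‖ ^ 2) ≤
          K * ε⁻¹ ^ 2 * (1 + |s.im|) ^ (3 / 4 - δ / 4) := by
  classical
  obtain ⟨Kk, hKk0, hKk⟩ := exists_sum_kernel_le
  have hsum2 := summable_inv_deriv_mul_norm_sq hRH hδ hC
  have hC0 := const_nonneg hC
  set S₂ : ℝ := ∑' ρ : ZetaZeros.riemannZetaNontrivialZeros,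
    1 / (‖deriv riemannZeta ρ‖ * ‖(ρ : ℂ)‖ ^ 2) with hS₂
  have hS₂F : ∀ F : Finset ℂ, (∀ ρ ∈ F, ρ ∈ ZetaZeros.riemannZetaNontrivialZeros) →
      ∑ ρ ∈ F, 1 / (‖deriv riemannZeta ρ‖ * ‖ρ‖ ^ 2) ≤ S₂ := fun F hF ↦
    sum_le_tsum_ntz (f := fun ρ ↦ 1 / (‖deriv riemannZeta ρ‖ * ‖ρ‖ ^ 2))
      (fun ρ ↦ by positivity) hsum2 F hF
  have hS₂0 : 0 ≤ S₂ := le_trans (by simp) (hS₂F ∅ (by simp))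
  set K' : ℝ := 2 ^ (5 / 2 : ℝ) * C * (Kk * (Real.log 2 + 1 / (δ / 2))) with hK'
  have hK'0 : 0 ≤ K' := by positivity
  refine ⟨Real.sqrt K' + 4 * S₂ + 1, by positivity, fun ε hε hε1 s hs hs1 F hF ↦ ?_⟩
  set t : ℝ := |s.im| with ht
  have ht0 : 0 ≤ t := abs_nonneg _
  set U : ℝ := 2 * |s.im| + 2 with hU
  -- split
  rw [← Finset.sum_filter_add_sum_filter_not F (fun ρ : ℂ ↦ |ρ.im| ≤ U)]
  have hnear := sum_near_le hRH hC hKk0 hKk hε hε1 hs (F.filter fun ρ : ℂ ↦ |ρ.im| ≤ U)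
    fun ρ hρ ↦ by
      rw [Finset.mem_filter] at hρ; exact ⟨hF ρ hρ.1, hρ.2⟩
  have hfar := sum_far_le hRH hsimp hS₂F s (F.filter fun ρ : ℂ ↦ ¬ |ρ.im| ≤ U) fun ρ hρ ↦ by
      rw [Finset.mem_filter, not_le] at hρ; exact ⟨hF ρ hρ.1, hρ.2⟩
  -- the near bound in closed form
  have hpow1 : (1 : ℝ) ≤ (1 + t) ^ (3 / 4 - δ / 4) :=
    Real.one_le_rpow (by linarith) (by linarith)
  have hε2 : (1 : ℝ) ≤ ε⁻¹ ^ 2 := by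
    have : 1 ≤ ε⁻¹ := one_le_inv_iff₀.2 ⟨hε, hε1⟩
    nlinarith
  have hA : 2 * C * U ^ (3 / 2 - δ) ≤ 2 ^ (5 / 2 : ℝ) * C * (1 + t) ^ (3 / 2 - δ) := by
    have hU' : U = 2 * (1 + t) := by rw [hU, ht]; ring
    rw [hU', Real.mul_rpow (by norm_num) (by linarith)]
    have h2 : (2 : ℝ) ^ (3 / 2 - δ) ≤ 2 ^ (3 / 2 : ℝ) :=
      Real.rpow_le_rpow_of_exponent_le (by norm_num) (by linarith)
    have e : (2 : ℝ) ^ (5 / 2 : ℝ) = 2 * 2 ^ (3 / 2 : ℝ) := by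
      rw [show (5 / 2 : ℝ) = 1 + 3 / 2 by norm_num, Real.rpow_add two_pos, Real.rpow_one]
    rw [e]
    have h0 : 0 ≤ (1 + t) ^ (3 / 2 - δ) := Real.rpow_nonneg (by linarith) _
    have := mul_le_mul_of_nonneg_right h2 (mul_nonneg hC0 h0)
    nlinarith
  have hB : Kk * Real.log (|s.im| + 2) ≤ Kk * (Real.log 2 + 1 / (δ / 2)) * (1 + t) ^ (δ / 2) := by
    rw [mul_assoc]
    refine mul_le_mul_of_nonneg_left ?_ hKk0.le
    rw [← ht]
    exact log_add_two_le_rpow_one_add (by positivity) ht0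
  have hAB : Real.sqrt (2 * C * U ^ (3 / 2 - δ)) * Real.sqrt (Kk * Real.log (|s.im| + 2)) ≤
      Real.sqrt K' * (1 + t) ^ (3 / 4 - δ / 4) := by
    rw [← Real.sqrt_mul (by positivity)]
    have h1 : 2 * C * U ^ (3 / 2 - δ) * (Kk * Real.log (|s.im| + 2)) ≤
        K' * (1 + t) ^ (3 / 2 - δ / 2) := by
      have h0 : 0 ≤ Kk * Real.log (|s.im| + 2) := by
        have : 0 ≤ Real.log (|s.im| + 2) := Real.log_nonneg (by linarith [abs_nonneg s.im])
        positivity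
      calc 2 * C * U ^ (3 / 2 - δ) * (Kk * Real.log (|s.im| + 2))
          ≤ (2 ^ (5 / 2 : ℝ) * C * (1 + t) ^ (3 / 2 - δ)) *
              (Kk * (Real.log 2 + 1 / (δ / 2)) * (1 + t) ^ (δ / 2)) :=
            mul_le_mul hA hB h0 (by positivity)
        _ = K' * ((1 + t) ^ (3 / 2 - δ) * (1 + t) ^ (δ / 2)) := by rw [hK']; ring
        _ = K' * (1 + t) ^ (3 / 2 - δ / 2) := by
            rw [← Real.rpow_add (by linarith)]; ring_nf
    calc Real.sqrt (2 * C * U ^ (3 / 2 - δ) * (Kk * Real.log (|s.im| + 2)))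
        ≤ Real.sqrt (K' * (1 + t) ^ (3 / 2 - δ / 2)) := Real.sqrt_le_sqrt h1
      _ = Real.sqrt K' * (1 + t) ^ (3 / 4 - δ / 4) := by
          rw [Real.sqrt_mul hK'0, Real.sqrt_eq_rpow ((1 + t) ^ (3 / 2 - δ / 2)),
            ← Real.rpow_mul (by linarith)]
          ring_nf
  have hnear' : ∑ ρ ∈ F.filter (fun ρ : ℂ ↦ |ρ.im| ≤ U), 1 / (‖deriv riemannZeta ρ‖ * ‖ρ - s‖ ^ 2) ≤
      ε⁻¹ ^ 2 * (Real.sqrt K' * (1 + t) ^ (3 / 4 - δ / 4)) :=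
    hnear.trans (mul_le_mul_of_nonneg_left hAB (by positivity))
  have hfar' : ∑ ρ ∈ F.filter (fun ρ : ℂ ↦ ¬ |ρ.im| ≤ U), 1 / (‖deriv riemannZeta ρ‖ * ‖ρ - s‖ ^ 2) ≤
      (4 * S₂ + 1) * ε⁻¹ ^ 2 * (1 + t) ^ (3 / 4 - δ / 4) := by
    refine hfar.trans ?_
    have h1 : 4 * S₂ ≤ (4 * S₂ + 1) * ε⁻¹ ^ 2 := by nlinarith
    have h2 : (4 * S₂ + 1) * ε⁻¹ ^ 2 ≤ (4 * S₂ + 1) * ε⁻¹ ^ 2 * (1 + t) ^ (3 / 4 - δ / 4) := by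
      have : 0 ≤ (4 * S₂ + 1) * ε⁻¹ ^ 2 := by positivity
      nlinarith
    linarith
  have hsqrt0 : 0 ≤ Real.sqrt K' := Real.sqrt_nonneg _
  calc ∑ ρ ∈ F.filter (fun ρ : ℂ ↦ |ρ.im| ≤ U), 1 / (‖deriv riemannZeta ρ‖ * ‖ρ - s‖ ^ 2) +
        ∑ ρ ∈ F.filter (fun ρ : ℂ ↦ ¬ |ρ.im| ≤ U), 1 / (‖deriv riemannZeta ρ‖ * ‖ρ - s‖ ^ 2)
      ≤ ε⁻¹ ^ 2 * (Real.sqrt K' * (1 + t) ^ (3 / 4 - δ / 4)) +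
          (4 * S₂ + 1) * ε⁻¹ ^ 2 * (1 + t) ^ (3 / 4 - δ / 4) := add_le_add hnear' hfar'
    _ = (Real.sqrt K' + 4 * S₂ + 1) * ε⁻¹ ^ 2 * (1 + t) ^ (3 / 4 - δ / 4) := by ring

/-- **The sum on a horizontal segment at a good height.** Assume RH, simple zeros and condition
(2) with `0 < δ`, and let `c₀ > 0`. There is `K > 0` such that for every `T` with `|T| ≥ 2`
all of whose distances from ordinates of non-trivial zeros are `≥ c₀/log(|T|+2)`, every real `σ`
and every finite set of distinct non-trivial zeros,
`∑ 1/(|ζ'(ρ)| |ρ − (σ+iT)|²) ≤ K |T|^{3/2}` (near zeros: `|ρ − s| ≥ |γ − T| ≥ c₀/log`, and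
`∑_{|γ| ≤ 3|T|} 1/|ζ'| ≪ |T|^{5/4}`; far zeros as in Lemma 3). [cite: BettinConreyFarmer2013, §3, proof of Thm. 1] -/
theorem exists_sum_horizontal_le (hRH : RiemannHypothesis)
    (hsimp : ∀ ρ : ℂ, riemannZeta ρ = 0 → 0 < ρ.re → ρ.re < 1 → deriv riemannZeta ρ ≠ 0)
    {δ C : ℝ} (hδ : 0 < δ)
    (hC : ∀ T : ℝ, 2 ≤ T →
      ∑ᶠ ρ ∈ zetaZeroBox 0 T, 1 / ‖deriv riemannZeta ρ‖ ^ 2 ≤ C * T ^ (3 / 2 - δ))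
    {c₀ : ℝ} (hc₀ : 0 < c₀) :
    ∃ K : ℝ, 0 < K ∧ ∀ T : ℝ, 2 ≤ |T| →
      (∀ ρ ∈ ZetaZeros.riemannZetaNontrivialZeros, c₀ / Real.log (|T| + 2) ≤ |ρ.im - T|) →
      ∀ σ : ℝ, ∀ F : Finset ℂ, (∀ ρ ∈ F, ρ ∈ ZetaZeros.riemannZetaNontrivialZeros) →
        ∑ ρ ∈ F, 1 / (‖deriv riemannZeta ρ‖ * ‖ρ - (σ + T * I)‖ ^ 2) ≤ K * |T| ^ (3 / 2 : ℝ) := by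
  classical
  obtain ⟨K₁, hK₁0, hK₁⟩ := sum_inv_deriv_le hRH hδ hC
  obtain ⟨Kℓ, hKℓ0, hKℓ⟩ := exists_log_le_rpow (a := 1 / 8) (by norm_num)
  have hsum2 := summable_inv_deriv_mul_norm_sq hRH hδ hC
  set S₂ : ℝ := ∑' ρ : ZetaZeros.riemannZetaNontrivialZeros,
    1 / (‖deriv riemannZeta ρ‖ * ‖(ρ : ℂ)‖ ^ 2) with hS₂
  have hS₂F : ∀ F : Finset ℂ, (∀ ρ ∈ F, ρ ∈ ZetaZeros.riemannZetaNontrivialZeros) →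
      ∑ ρ ∈ F, 1 / (‖deriv riemannZeta ρ‖ * ‖ρ‖ ^ 2) ≤ S₂ := fun F hF ↦
    sum_le_tsum_ntz (f := fun ρ ↦ 1 / (‖deriv riemannZeta ρ‖ * ‖ρ‖ ^ 2))
      (fun ρ ↦ by positivity) hsum2 F hF
  have hS₂0 : 0 ≤ S₂ := le_trans (by simp) (hS₂F ∅ (by simp))
  refine ⟨4 * K₁ * Kℓ ^ 2 / c₀ ^ 2 + 4 * S₂ + 1, by positivity, fun T hT hgood σ F hF ↦ ?_⟩
  set s : ℂ := σ + T * I with hs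
  have hsim : s.im = T := by simp [hs]
  have hT0 : 0 < |T| := by linarith
  set U : ℝ := 2 * |s.im| + 2 with hU
  have hUT : U ≤ 3 * |T| := by rw [hU, hsim]; linarith
  have hU2 : 2 ≤ U := by rw [hU]; linarith [abs_nonneg s.im]
  rw [← Finset.sum_filter_add_sum_filter_not F (fun ρ : ℂ ↦ |ρ.im| ≤ U)]
  -- far zeros
  have hfar := sum_far_le hRH hsimp hS₂F s (F.filter fun ρ : ℂ ↦ ¬ |ρ.im| ≤ U) fun ρ hρ ↦ by
      rw [Finset.mem_filter, not_le] at hρ; exact ⟨hF ρ hρ.1, hρ.2⟩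
  -- near zeros: `1/|ρ-s|² ≤ log²(|T|+2)/c₀²`
  set Fn := F.filter (fun ρ : ℂ ↦ |ρ.im| ≤ U) with hFn
  have hlogpos : 0 < Real.log (|T| + 2) := Real.log_pos (by linarith)
  have hnear : ∑ ρ ∈ Fn, 1 / (‖deriv riemannZeta ρ‖ * ‖ρ - s‖ ^ 2) ≤
      (Real.log (|T| + 2) / c₀) ^ 2 * (K₁ * U ^ (5 / 4 - δ / 4)) := by
    have h1 := hK₁ U hU2 Fn fun ρ hρ ↦ by
      rw [hFn, Finset.mem_filter] at hρ; exact ⟨hF ρ hρ.1, hρ.2⟩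
    calc ∑ ρ ∈ Fn, 1 / (‖deriv riemannZeta ρ‖ * ‖ρ - s‖ ^ 2)
        ≤ ∑ ρ ∈ Fn, (Real.log (|T| + 2) / c₀) ^ 2 * (1 / ‖deriv riemannZeta ρ‖) := by
          refine Finset.sum_le_sum fun ρ hρ ↦ ?_
          have hmem : ρ ∈ ZetaZeros.riemannZetaNontrivialZeros := by
            rw [hFn, Finset.mem_filter] at hρ; exact hF ρ hρ.1
          have hd : 0 < ‖deriv riemannZeta ρ‖ := norm_pos_iff.2 (ntz_deriv_ne_zero hsimp hmem)
          have hsep := hgood ρ hmem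
          have hseppos : 0 < c₀ / Real.log (|T| + 2) := by positivity
          have him : |ρ.im - T| ≤ ‖ρ - s‖ := by
            have := Complex.abs_im_le_norm (ρ - s)
            rwa [sub_im, hsim] at this
          have hρs : 0 < ‖ρ - s‖ := hseppos.trans_le (hsep.trans him)
          have hq : c₀ / Real.log (|T| + 2) ≤ ‖ρ - s‖ := hsep.trans him
          rw [mul_one_div, div_le_div_iff₀ (by positivity) hd, one_mul]
          have hq2 : (c₀ / Real.log (|T| + 2)) ^ 2 ≤ ‖ρ - s‖ ^ 2 :=
            pow_le_pow_left₀ hseppos.le hq 2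
          have e : (Real.log (|T| + 2) / c₀) ^ 2 * (c₀ / Real.log (|T| + 2)) ^ 2 = 1 := by
            field_simp
          calc ‖deriv riemannZeta ρ‖ = ((Real.log (|T| + 2) / c₀) ^ 2 *
                (c₀ / Real.log (|T| + 2)) ^ 2) * ‖deriv riemannZeta ρ‖ := by rw [e, one_mul]
            _ ≤ ((Real.log (|T| + 2) / c₀) ^ 2 * ‖ρ - s‖ ^ 2) * ‖deriv riemannZeta ρ‖ := by
                gcongr
            _ = (Real.log (|T| + 2) / c₀) ^ 2 * (‖deriv riemannZeta ρ‖ * ‖ρ - s‖ ^ 2) := by ring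
      _ = (Real.log (|T| + 2) / c₀) ^ 2 * ∑ ρ ∈ Fn, 1 / ‖deriv riemannZeta ρ‖ := by
          rw [Finset.mul_sum]
      _ ≤ (Real.log (|T| + 2) / c₀) ^ 2 * (K₁ * U ^ (5 / 4 - δ / 4)) :=
          mul_le_mul_of_nonneg_left h1 (by positivity)
  -- numerical massaging
  have hlog := hKℓ |T| hT
  have hlog2 : Real.log (|T| + 2) ^ 2 ≤ Kℓ ^ 2 * |T| ^ (1 / 4 : ℝ) := by
    calc Real.log (|T| + 2) ^ 2 ≤ (Kℓ * |T| ^ (1 / 8 : ℝ)) ^ 2 :=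
          pow_le_pow_left₀ hlogpos.le hlog 2
      _ = Kℓ ^ 2 * |T| ^ (1 / 4 : ℝ) := by
          rw [mul_pow, ← Real.rpow_mul_natCast hT0.le]; norm_num
  have hUpow : U ^ (5 / 4 - δ / 4) ≤ 4 * |T| ^ (5 / 4 : ℝ) := by
    have h1 : U ^ (5 / 4 - δ / 4) ≤ U ^ (5 / 4 : ℝ) :=
      Real.rpow_le_rpow_of_exponent_le (by linarith) (by linarith)
    have h2 : U ^ (5 / 4 : ℝ) ≤ (3 * |T|) ^ (5 / 4 : ℝ) :=
      Real.rpow_le_rpow (by linarith) hUT (by norm_num)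
    have h3 : (3 * |T|) ^ (5 / 4 : ℝ) = 3 ^ (5 / 4 : ℝ) * |T| ^ (5 / 4 : ℝ) :=
      Real.mul_rpow (by norm_num) hT0.le
    have h4 : (3 : ℝ) ^ (5 / 4 : ℝ) ≤ 4 := by
      have : (3 : ℝ) ^ (5 / 4 : ℝ) ≤ 3 ^ (3 / 2 : ℝ) :=
        Real.rpow_le_rpow_of_exponent_le (by norm_num) (by norm_num)
      have h9 : (3 : ℝ) ^ (3 / 2 : ℝ) ≤ 4 ^ (3 / 2 : ℝ) := Real.rpow_le_rpow (by norm_num) (by norm_num) (by norm_num)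
      have h8 : (4 : ℝ) ^ (3 / 2 : ℝ) = 8 := by
        rw [show (4 : ℝ) = 2 ^ (2 : ℝ) by norm_num, ← Real.rpow_mul (by norm_num)]; norm_num
      -- cruder: `3^{5/4} ≤ 3^{3/2} ≤ 8`? too weak for `≤ 4`; use `3^{5/4} ≤ 3 · 3^{1/4} ≤ 3 · 4/3`
      have h5 : (3 : ℝ) ^ (5 / 4 : ℝ) = 3 * 3 ^ (1 / 4 : ℝ) := by
        rw [show (5 / 4 : ℝ) = 1 + 1 / 4 by norm_num, Real.rpow_add (by norm_num), Real.rpow_one]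
      have h6 : (3 : ℝ) ^ (1 / 4 : ℝ) ≤ 4 / 3 := by
        have h7 : ((4 : ℝ) / 3) ^ (4 : ℝ) = 256 / 81 := by
          rw [show (4 : ℝ) = ((4 : ℕ) : ℝ) by norm_num, Real.rpow_natCast]; norm_num
        have : (3 : ℝ) ≤ (4 / 3) ^ (4 : ℝ) := by rw [h7]; norm_num
        calc (3 : ℝ) ^ (1 / 4 : ℝ) ≤ ((4 / 3 : ℝ) ^ (4 : ℝ)) ^ (1 / 4 : ℝ) :=
              Real.rpow_le_rpow (by norm_num) this (by norm_num)
          _ = 4 / 3 := by rw [← Real.rpow_mul (by norm_num)]; norm_num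
      rw [h5]; linarith
    calc U ^ (5 / 4 - δ / 4) ≤ (3 * |T|) ^ (5 / 4 : ℝ) := h1.trans h2
      _ = 3 ^ (5 / 4 : ℝ) * |T| ^ (5 / 4 : ℝ) := h3
      _ ≤ 4 * |T| ^ (5 / 4 : ℝ) :=
          mul_le_mul_of_nonneg_right h4 (Real.rpow_nonneg hT0.le _)
  have hnear' : ∑ ρ ∈ Fn, 1 / (‖deriv riemannZeta ρ‖ * ‖ρ - s‖ ^ 2) ≤
      4 * K₁ * Kℓ ^ 2 / c₀ ^ 2 * |T| ^ (3 / 2 : ℝ) := by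
    refine hnear.trans ?_
    rw [div_pow]
    have e : |T| ^ (3 / 2 : ℝ) = |T| ^ (1 / 4 : ℝ) * |T| ^ (5 / 4 : ℝ) := by
      rw [← Real.rpow_add hT0]; norm_num
    calc Real.log (|T| + 2) ^ 2 / c₀ ^ 2 * (K₁ * U ^ (5 / 4 - δ / 4))
        ≤ (Kℓ ^ 2 * |T| ^ (1 / 4 : ℝ)) / c₀ ^ 2 * (K₁ * (4 * |T| ^ (5 / 4 : ℝ))) := by
          refine mul_le_mul (div_le_div_of_nonneg_right hlog2 (by positivity))
            (mul_le_mul_of_nonneg_left hUpow hK₁0.le) (by positivity) (by positivity)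
      _ = 4 * K₁ * Kℓ ^ 2 / c₀ ^ 2 * |T| ^ (3 / 2 : ℝ) := by rw [e]; ring
  have hTpow : (1 : ℝ) ≤ |T| ^ (3 / 2 : ℝ) := Real.one_le_rpow (by linarith) (by norm_num)
  have hfar' : ∑ ρ ∈ F.filter (fun ρ : ℂ ↦ ¬ |ρ.im| ≤ U), 1 / (‖deriv riemannZeta ρ‖ * ‖ρ - s‖ ^ 2) ≤
      (4 * S₂ + 1) * |T| ^ (3 / 2 : ℝ) := by
    refine hfar.trans ?_
    have : 0 ≤ 4 * S₂ + 1 := by positivity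
    nlinarith
  have hK0 : 0 ≤ 4 * K₁ * Kℓ ^ 2 / c₀ ^ 2 := by positivity
  calc ∑ ρ ∈ Fn, 1 / (‖deriv riemannZeta ρ‖ * ‖ρ - s‖ ^ 2) +
        ∑ ρ ∈ F.filter (fun ρ : ℂ ↦ ¬ |ρ.im| ≤ U), 1 / (‖deriv riemannZeta ρ‖ * ‖ρ - s‖ ^ 2)
      ≤ 4 * K₁ * Kℓ ^ 2 / c₀ ^ 2 * |T| ^ (3 / 2 : ℝ) + (4 * S₂ + 1) * |T| ^ (3 / 2 : ℝ) :=
        add_le_add hnear' hfar'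
    _ = (4 * K₁ * Kℓ ^ 2 / c₀ ^ 2 + 4 * S₂ + 1) * |T| ^ (3 / 2 : ℝ) := by ring

end BCF

end Literature.NumberTheory.LFunctions

end
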